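/-
Copyright (c) 2026 the pub-hodgecm-mathlib formalisation cell (harness21).  Prover seat hodgecm-mathlib-LH5-p04 (g6), line LH5 (closer stub
`stub_S1finTFCovol`), glue brick (g4) «ARCH × FIN SHUFFLE OF THE BLOCK-DIAGONAL EMBEDDING» of the (M-Z1♭-RED) glue list (census 7285f7ff §2); 2026-09-02.
-/
import Literature.NumberTheory.Weil1964.UnitaryArchSingularCentralizerTopFormHaar   -- ★ B2a: `archBlockDiag`
import Literature.NumberTheory.Automorphic.UnitaryGroupAdelicProduct                 -- ★ `archPart`, `finPart`, `adelicProdEquiv`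
import Literature.NumberTheory.Automorphic.UnitaryGroupDirectSumCarriersFinite        -- ★ `finAdelicBlockDiag`
import Literature.NumberTheory.Automorphic.AdelicUnitaryGroupDatum                   -- ★ `cmDatum`
import HarnessLib

/-!
# The block-diagonal embedding commutes with the archimedean and finite components: `(u₁ ⊕ᶠ u₂)_∞ = (u₁)_∞ ⊕ᶠ (u₂)_∞`, `(u₁ ⊕ᶠ u₂)_f = (u₁)_f ⊕ᶠ (u₂)_f`
(Borel–Jacquet 1979 §4.1 `G(𝔸) = G_∞ × G(𝔸_f)`, functorial in the block-diagonal inclusion `U(W₁) × U(W₂) ⊂ U(W₁ ⊕ W₂)`; Rogawski 1990 §3.8 Prop. 3.8.1 (a))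

Topic `NumberTheory/Weil1964`; namespace `Literature.NumberTheory.Weil1964.UnitaryArchTopForm` (where ★ `archBlockDiag` lives).  THEOREMS ONLY (no definition, no instance, no
notation, no named fact, no `sorry`).  Over ★ `UnitaryGroupAdelicProduct` (`archPart`, `finPart`, `adelicProdEquiv : U(J)(𝔸_F) ≃ₜ* U(J)(E ⊗ ℝ) × U(J)(𝔸_{F,f})`), ★
`UnitaryGroupDirectSumCarriers[Finite]` (`adelicBlockDiag`, `finAdelicBlockDiag`), ★ B2a (`archBlockDiag`), and ★ `UnitaryGroupDirectSum` (`map_reindexGL`, `map_blockDiagGL`).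

* §1 (generic `F, E, c`, sizes `M₁ + M₂`, `J₁ J₂`) **`finPart_adelicBlockDiag`**, **`archPart_adelicBlockDiag`** (and their `GL` forms, and primed PAIR forms `…'` for `∀ u : _ × _` consumers), **`adelicProdEquiv_adelicBlockDiag`**:
  `adelicProdEquiv (u₁ ⊕ᶠ u₂) = ((u₁)_∞ ⊕ᶠ (u₂)_∞, (u₁)_f ⊕ᶠ (u₂)_f)` — `finPart` is `GL(RingHom.snd)`, `archPart` is `GL(ringEquiv_mixedSpace ∘ RingHom.fst)`, and `GL(f)` commutes with
  `reindexGL ∘ blockDiagGL` (★ `map_reindexGL`, `map_blockDiagGL`).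
* §2 (CM currency, the tokens of the LH5 letter Z1♭ and of ★ `UnitaryGroupBlockDiagCentralizerEquiv` §3's FORMULA clause): for `g : (cmDatum L 3 (Ha ⊕ᶠ Hb)).Adelic`,
  `ua : (cmDatum L 2 Ha).Adelic`, `ub : (cmDatum L 1 Hb).Adelic` with `g.val = reindexGL finSumFinEquiv (blockDiagGL (ua.val, ub.val))`:
  **`archPart_eq_archBlockDiag_of_val_eq`**, **`finPart_eq_finAdelicBlockDiag_of_val_eq`** — so for Z1♭'s `e = (adelicProdEquiv …).symm.toMulEquiv` and the centraliser isomorphism `e₃` of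
  ★ `exists_continuousMulEquiv_centralizer_cmDatum_toAdelic_of_eq_finSum`, `e.symm (e₃ u) = ((u.1)_∞ ⊕ᶠ (u.2)_∞, (u.1)_f ⊕ᶠ (u.2)_f)`: the box-preimage hypothesis `hB` of ★
  `HaarProductPinning.map_prod_eq_of_apply_eq_of_preimage_eq` becomes set algebra on the blocks.
HONEST LABEL: count-neutral plumbing; no organ of the LH5 line is paid; HC_CM is proved only modulo the printed citations until rung 0 closes.

## References
* A. Borel, H. Jacquet, *Automorphic forms and automorphic representations*, Proc. Sympos. Pure Math. 33 Part 1 (1979), §4.1. [BorelJacquet1979]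
* J. Rogawski, *Automorphic Representations of Unitary Groups in Three Variables*, Ann. of Math. Stud. 123 (1990), §3.8 Prop. 3.8.1 (a) p. 27. [Rogawski1990]
-/

set_option autoImplicit false

noncomputable section

open NumberField NumberField.mixedEmbedding IsDedekindDomain
open Literature.NumberTheory.Automorphic Literature.NumberTheory.Automorphic.UnitaryGroup
open scoped Matrix MatrixGroups

namespace Literature.NumberTheory.Weil1964

namespace UnitaryArchTopForm

/-! ## §1 Generic: the components of `u₁ ⊕ᶠ u₂` -/

section Generic

variable (F E : Type) [Field F] [NumberField F] [Field E] [NumberField E] [Algebra F E]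
  (c : E ≃ₐ[F] E) (M₁ M₂ : ℕ) (J₁ : Matrix (Fin M₁) (Fin M₁) E) (J₂ : Matrix (Fin M₂) (Fin M₂) E)

/-- `GL_N(𝔸_E) → GL_N(E ⊗ ℝ)` (★ `GLn.toMixed`) is `GL` of the ring map `𝔸_E → E_∞ ≃ mixedSpace E` (definitional, entrywise). [cite: BorelJacquet1979, §4.1] -/
private theorem toMixed_eq_map (N : ℕ) (g : GL (Fin N) (AdeleRing (𝓞 E) E)) :
    GLn.toMixed N E g = Matrix.GeneralLinearGroup.map (R := AdeleRing (𝓞 E) E) (S := mixedSpace E)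
      ((InfiniteAdeleRing.ringEquiv_mixedSpace E).toRingHom.comp (RingHom.fst (InfiniteAdeleRing E) (FiniteAdeleRing (𝓞 E) E))) g :=
  Units.ext (Matrix.ext fun _ _ => rfl)

/-- **`(u₁ ⊕ᶠ u₂)_f = (u₁)_f ⊕ᶠ (u₂)_f` in `GL_{M₁+M₂}(𝔸_E^∞)`**. [cite: BorelJacquet1979, §4.1] -/
theorem coe_finPart_adelicBlockDiag (u₁ : adelic F E c M₁ J₁) (u₂ : adelic F E c M₂ J₂) :
    ((finPart F E c (M₁ + M₂) (finSum M₁ M₂ J₁ J₂) (adelicBlockDiag F E c M₁ M₂ J₁ J₂ (u₁, u₂)) :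
        finAdelic F E c (M₁ + M₂) (finSum M₁ M₂ J₁ J₂)) : GL (Fin (M₁ + M₂)) (FiniteAdeleRing (𝓞 E) E)) =
      reindexGL finSumFinEquiv (blockDiagGL
        (((finPart F E c M₁ J₁ u₁ : finAdelic F E c M₁ J₁) : GL (Fin M₁) (FiniteAdeleRing (𝓞 E) E)),
         ((finPart F E c M₂ J₂ u₂ : finAdelic F E c M₂ J₂) : GL (Fin M₂) (FiniteAdeleRing (𝓞 E) E)))) := by
  rw [coe_finPart, coe_finPart, coe_finPart, adelicVal_apply, adelicVal_apply, adelicVal_apply, coe_adelicBlockDiag]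
  exact (map_reindexGL _ _ _).trans (by rw [map_blockDiagGL])

/-- **`(u₁ ⊕ᶠ u₂)_f = (u₁)_f ⊕ᶠ (u₂)_f`**: the finite component of a block-diagonal adelic point is the block-diagonal of the finite components
(★ `finAdelicBlockDiag`). [cite: BorelJacquet1979, §4.1] [cite: Rogawski1990, §3.8 Prop. 3.8.1 p. 27] -/
theorem finPart_adelicBlockDiag (u₁ : adelic F E c M₁ J₁) (u₂ : adelic F E c M₂ J₂) :
    finPart F E c (M₁ + M₂) (finSum M₁ M₂ J₁ J₂) (adelicBlockDiag F E c M₁ M₂ J₁ J₂ (u₁, u₂)) =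
      finAdelicBlockDiag F E c M₁ M₂ J₁ J₂ (finPart F E c M₁ J₁ u₁, finPart F E c M₂ J₂ u₂) :=
  Subtype.ext (by rw [coe_finPart_adelicBlockDiag, coe_finAdelicBlockDiag])

/-- **`(u₁ ⊕ᶠ u₂)_∞ = (u₁)_∞ ⊕ᶠ (u₂)_∞` in `GL_{M₁+M₂}(E ⊗ ℝ)`**. [cite: BorelJacquet1979, §4.1] -/
theorem coe_archPart_adelicBlockDiag (u₁ : adelic F E c M₁ J₁) (u₂ : adelic F E c M₂ J₂) :
    ((archPart F E c (M₁ + M₂) (finSum M₁ M₂ J₁ J₂) (adelicBlockDiag F E c M₁ M₂ J₁ J₂ (u₁, u₂)) :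
        arch F E c (M₁ + M₂) (finSum M₁ M₂ J₁ J₂)) : GL (Fin (M₁ + M₂)) (mixedSpace E)) =
      reindexGL finSumFinEquiv (blockDiagGL
        (((archPart F E c M₁ J₁ u₁ : arch F E c M₁ J₁) : GL (Fin M₁) (mixedSpace E)),
         ((archPart F E c M₂ J₂ u₂ : arch F E c M₂ J₂) : GL (Fin M₂) (mixedSpace E)))) := by
  rw [coe_archPart, coe_archPart, coe_archPart, adelicVal_apply, adelicVal_apply, adelicVal_apply, coe_adelicBlockDiag,
    toMixed_eq_map, toMixed_eq_map, toMixed_eq_map]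
  exact (map_reindexGL _ _ _).trans (by rw [map_blockDiagGL])

/-- **`(u₁ ⊕ᶠ u₂)_∞ = (u₁)_∞ ⊕ᶠ (u₂)_∞`**: the archimedean component of a block-diagonal adelic point is the block-diagonal of the archimedean components
(★ `archBlockDiag`). [cite: BorelJacquet1979, §4.1] [cite: Rogawski1990, §3.8 Prop. 3.8.1 p. 27] -/
theorem archPart_adelicBlockDiag (u₁ : adelic F E c M₁ J₁) (u₂ : adelic F E c M₂ J₂) :
    archPart F E c (M₁ + M₂) (finSum M₁ M₂ J₁ J₂) (adelicBlockDiag F E c M₁ M₂ J₁ J₂ (u₁, u₂)) =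
      archBlockDiag F E c J₁ J₂ (archPart F E c M₁ J₁ u₁, archPart F E c M₂ J₂ u₂) :=
  Subtype.ext (by rw [coe_archPart_adelicBlockDiag, coe_archBlockDiag])

/-- **`U(J₁ ⊕ᶠ J₂)(𝔸_F) ≃ U(E ⊗ ℝ) × U(𝔸_{F,f})` IS BLOCKWISE**: `adelicProdEquiv (u₁ ⊕ᶠ u₂) = ((u₁)_∞ ⊕ᶠ (u₂)_∞, (u₁)_f ⊕ᶠ (u₂)_f)`.
[cite: BorelJacquet1979, §4.1] [cite: Rogawski1990, §3.8 Prop. 3.8.1 p. 27] -/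
theorem adelicProdEquiv_adelicBlockDiag (u₁ : adelic F E c M₁ J₁) (u₂ : adelic F E c M₂ J₂) :
    adelicProdEquiv F E c (M₁ + M₂) (finSum M₁ M₂ J₁ J₂) (adelicBlockDiag F E c M₁ M₂ J₁ J₂ (u₁, u₂)) =
      (archBlockDiag F E c J₁ J₂ (archPart F E c M₁ J₁ u₁, archPart F E c M₂ J₂ u₂),
       finAdelicBlockDiag F E c M₁ M₂ J₁ J₂ (finPart F E c M₁ J₁ u₁, finPart F E c M₂ J₂ u₂)) := by
  rw [adelicProdEquiv_apply, archPart_adelicBlockDiag, finPart_adelicBlockDiag]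

/-- Pair form of `finPart_adelicBlockDiag` (for consumers quantifying `∀ u : U(J₁)(𝔸) × U(J₂)(𝔸)`, as ★ `exists_continuousMulEquiv_centralizer_toAdelic_coe_eq_adelicBlockDiag`
does): `(adelicBlockDiag u)_f = (u.1)_f ⊕ᶠ (u.2)_f`. [cite: BorelJacquet1979, §4.1] -/
theorem finPart_adelicBlockDiag' (u : adelic F E c M₁ J₁ × adelic F E c M₂ J₂) :
    finPart F E c (M₁ + M₂) (finSum M₁ M₂ J₁ J₂) (adelicBlockDiag F E c M₁ M₂ J₁ J₂ u) =
      finAdelicBlockDiag F E c M₁ M₂ J₁ J₂ (finPart F E c M₁ J₁ u.1, finPart F E c M₂ J₂ u.2) :=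
  finPart_adelicBlockDiag F E c M₁ M₂ J₁ J₂ u.1 u.2

/-- Pair form of `archPart_adelicBlockDiag`: `(adelicBlockDiag u)_∞ = (u.1)_∞ ⊕ᶠ (u.2)_∞`. [cite: BorelJacquet1979, §4.1] -/
theorem archPart_adelicBlockDiag' (u : adelic F E c M₁ J₁ × adelic F E c M₂ J₂) :
    archPart F E c (M₁ + M₂) (finSum M₁ M₂ J₁ J₂) (adelicBlockDiag F E c M₁ M₂ J₁ J₂ u) =
      archBlockDiag F E c J₁ J₂ (archPart F E c M₁ J₁ u.1, archPart F E c M₂ J₂ u.2) :=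
  archPart_adelicBlockDiag F E c M₁ M₂ J₁ J₂ u.1 u.2

/-- Pair form of `adelicProdEquiv_adelicBlockDiag`: `adelicProdEquiv (adelicBlockDiag u) = ((u.1)_∞ ⊕ᶠ (u.2)_∞, (u.1)_f ⊕ᶠ (u.2)_f)` — composes with Z1♭'s
`e = (adelicProdEquiv …).symm.toMulEquiv` by `Equiv.symm_apply_eq` in one step. [cite: BorelJacquet1979, §4.1] -/
theorem adelicProdEquiv_adelicBlockDiag' (u : adelic F E c M₁ J₁ × adelic F E c M₂ J₂) :
    adelicProdEquiv F E c (M₁ + M₂) (finSum M₁ M₂ J₁ J₂) (adelicBlockDiag F E c M₁ M₂ J₁ J₂ u) =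
      (archBlockDiag F E c J₁ J₂ (archPart F E c M₁ J₁ u.1, archPart F E c M₂ J₂ u.2),
       finAdelicBlockDiag F E c M₁ M₂ J₁ J₂ (finPart F E c M₁ J₁ u.1, finPart F E c M₂ J₂ u.2)) :=
  adelicProdEquiv_adelicBlockDiag F E c M₁ M₂ J₁ J₂ u.1 u.2

end Generic

/-! ## §2 CM currency: elements of `U(Ha ⊕ᶠ Hb)(𝔸_{L⁺})` whose matrix is block diagonal -/

section CM

variable (L : Type) [Field L] [NumberField L] [IsCMField L] (Ha : Matrix (Fin 2) (Fin 2) L) (Hb : Matrix (Fin 1) (Fin 1) L)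

/-- **Archimedean component of a block-diagonal element, `cmDatum` currency**: if `g ∈ U(Ha ⊕ᶠ Hb)(𝔸_{L⁺})` has matrix `ua ⊕ᶠ ub` with `ua ∈ U(Ha)(𝔸_{L⁺})`,
`ub ∈ U(Hb)(𝔸_{L⁺})` (the FORMULA clause of ★ `exists_continuousMulEquiv_centralizer_cmDatum_toAdelic_of_eq_finSum`), then `g_∞ = (ua)_∞ ⊕ᶠ (ub)_∞` (★ `archBlockDiag`).
[cite: BorelJacquet1979, §4.1] [cite: Rogawski1990, §3.8 Prop. 3.8.1 p. 27] -/
theorem archPart_eq_archBlockDiag_of_val_eq (g : (cmDatum L 3 (finSum 2 1 Ha Hb)).Adelic) (ua : (cmDatum L 2 Ha).Adelic) (ub : (cmDatum L 1 Hb).Adelic)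
    (hg : (g.val : GL (Fin 3) (AdeleRing (𝓞 L) L)) = reindexGL finSumFinEquiv (blockDiagGL (ua.val, ub.val))) :
    archPart (↥(maximalRealSubfield L)) L (IsCMField.complexConj L) 3 (finSum 2 1 Ha Hb) g =
      archBlockDiag (↥(maximalRealSubfield L)) L (IsCMField.complexConj L) Ha Hb
        (archPart (↥(maximalRealSubfield L)) L (IsCMField.complexConj L) 2 Ha ua,
         archPart (↥(maximalRealSubfield L)) L (IsCMField.complexConj L) 1 Hb ub) := by
  apply Subtype.ext
  rw [coe_archBlockDiag, coe_archPart, coe_archPart, coe_archPart, adelicVal_apply, adelicVal_apply, adelicVal_apply]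
  show GLn.toMixed 3 L g.val = reindexGL finSumFinEquiv (blockDiagGL (GLn.toMixed 2 L ua.val, GLn.toMixed 1 L ub.val))
  rw [hg, toMixed_eq_map, toMixed_eq_map, toMixed_eq_map]
  exact (map_reindexGL _ _ _).trans (by rw [map_blockDiagGL])

/-- **Finite component of a block-diagonal element, `cmDatum` currency**: under the same hypothesis `g_f = (ua)_f ⊕ᶠ (ub)_f` (★ `finAdelicBlockDiag`).
[cite: BorelJacquet1979, §4.1] [cite: Rogawski1990, §3.8 Prop. 3.8.1 p. 27] -/
theorem finPart_eq_finAdelicBlockDiag_of_val_eq (g : (cmDatum L 3 (finSum 2 1 Ha Hb)).Adelic) (ua : (cmDatum L 2 Ha).Adelic) (ub : (cmDatum L 1 Hb).Adelic)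
    (hg : (g.val : GL (Fin 3) (AdeleRing (𝓞 L) L)) = reindexGL finSumFinEquiv (blockDiagGL (ua.val, ub.val))) :
    finPart (↥(maximalRealSubfield L)) L (IsCMField.complexConj L) 3 (finSum 2 1 Ha Hb) g =
      finAdelicBlockDiag (↥(maximalRealSubfield L)) L (IsCMField.complexConj L) 2 1 Ha Hb
        (finPart (↥(maximalRealSubfield L)) L (IsCMField.complexConj L) 2 Ha ua,
         finPart (↥(maximalRealSubfield L)) L (IsCMField.complexConj L) 1 Hb ub) := by
  apply Subtype.ext
  rw [coe_finAdelicBlockDiag, coe_finPart, coe_finPart, coe_finPart, adelicVal_apply, adelicVal_apply, adelicVal_apply]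
  show GLn.sndHom 3 L g.val = reindexGL finSumFinEquiv (blockDiagGL (GLn.sndHom 2 L ua.val, GLn.sndHom 1 L ub.val))
  rw [hg]
  exact (map_reindexGL _ _ _).trans (by rw [map_blockDiagGL])

/-- **Both components at once**: `adelicProdEquiv g = ((ua)_∞ ⊕ᶠ (ub)_∞, (ua)_f ⊕ᶠ (ub)_f)` for a block-diagonal `g` (so, for Z1♭'s
`e = (adelicProdEquiv …).symm.toMulEquiv`, `e.symm g` is that pair). [cite: BorelJacquet1979, §4.1] [cite: Rogawski1990, §3.8 Prop. 3.8.1 p. 27] -/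
theorem adelicProdEquiv_eq_of_val_eq (g : (cmDatum L 3 (finSum 2 1 Ha Hb)).Adelic) (ua : (cmDatum L 2 Ha).Adelic) (ub : (cmDatum L 1 Hb).Adelic)
    (hg : (g.val : GL (Fin 3) (AdeleRing (𝓞 L) L)) = reindexGL finSumFinEquiv (blockDiagGL (ua.val, ub.val))) :
    adelicProdEquiv (↥(maximalRealSubfield L)) L (IsCMField.complexConj L) 3 (finSum 2 1 Ha Hb) g =
      (archBlockDiag (↥(maximalRealSubfield L)) L (IsCMField.complexConj L) Ha Hb
          (archPart (↥(maximalRealSubfield L)) L (IsCMField.complexConj L) 2 Ha ua,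
           archPart (↥(maximalRealSubfield L)) L (IsCMField.complexConj L) 1 Hb ub),
       finAdelicBlockDiag (↥(maximalRealSubfield L)) L (IsCMField.complexConj L) 2 1 Ha Hb
          (finPart (↥(maximalRealSubfield L)) L (IsCMField.complexConj L) 2 Ha ua,
           finPart (↥(maximalRealSubfield L)) L (IsCMField.complexConj L) 1 Hb ub)) := by
  rw [adelicProdEquiv_apply, archPart_eq_archBlockDiag_of_val_eq L Ha Hb g ua ub hg, finPart_eq_finAdelicBlockDiag_of_val_eq L Ha Hb g ua ub hg]

end CM

end UnitaryArchTopForm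

end Literature.NumberTheory.Weil1964

end
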